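import Summits.Ventures.LatticeQCDFlow.Exactness.Phi4MetropolisPhaseLabelCSD
import Summits.Ventures.LatticeQCDFlow.Exactness.Phi4FlowSignMagnetisation
import HarnessLib

/-!
# TUNNELLING EVENTS CERTIFY A FLOOR, I (local arm): `τ_int,sweep(θ) ≥ Var(θ)/(2 V ⟨r_flip⟩) − ½`

HONEST FRAMING: exact (Metropolis-corrected) sampling algorithms for lattice gauge theory;
figures of merit are autocorrelation/cost numbers at stated couplings and volumes; no
continuum-physics claim.  (SCALAR calibration rung S0-A: not a gauge result.)

Venture `LatticeQCDFlow` (cell pub-lqcd), topic `Exactness`; FANOUT row 2 (`s0-phi4`, all three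
arms; this file: the LOCAL arm and the shared lemmas, the HMC and FLOW arms are
`Exactness/Phi4PhaseLabelFlipRateHMCFlow.lean`).  NEW WORK of the cell, composing the
carré-du-champ floors of the three arms
(`Phi4MetropolisScan` + `ReversibleDirichletFloor` for the random-scan local Metropolis operator,
`Phi4HMCCarreDuChamp.hmc_tauInt_ge_of_msd_le` for every HMC-type update, `IMHDirichletForm` +
`FlowSamplerTauIntFloor` for the flow sampler) with one remark: for a `±1`-valued PHASE LABEL `θ` the
squared jump `(θ' − θ)²` is `4 ×` the indicator of a LABEL CHANGE, so the mean squared accepted jump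
of `θ` per update is `4 r_flip`, `r_flip` the equilibrium probability that one update changes the
label (a "tunnelling event").  Nothing is cited as a fact; the practice of counting tunnelling events
of the topological charge / of `sgn M` as a mixing diagnostic is folklore of the lattice literature
(e.g. the `τ(Q²)` vs. tunnelling-rate tables of topology-freezing studies), named only.

## What is proved in the pair of files (`Λ = Fin (n+1)`, `V = n+1`, `λ > 0`, any `J`; `F` measurable, `c` a level,
`θ = ±1` the label of `{c ≤ F}`, `Var(θ) = ⟨(θ − ⟨θ⟩)²⟩`; `χ_flip(ψ, φ) = 1` iff the labels of
`ψ` and `φ` differ)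

* `label_sq_sub_eq_four_mul_flip` — `(θ ψ − θ φ)² = 4 χ_flip(ψ, φ)`;
* LOCAL arm (`K = metroScan J λ ρ`, `ρ` an even probability density, one sweep = `V` proposals,
  `r(φ) = K[χ_flip(·, φ)](φ)` the probability that the next proposal is accepted AND flips the label):
  `metroScan_labelDev_eq_flip` (`K[(θ − θ φ)²](φ) = 4 r(φ)`) and
  **`metropolisScan_tauInt_sweep_ge_flipRate`** — `τ_int,sweep(θ) ≥ Var(θ)/(2 V ⟨r⟩) − ½`
  (`V⟨r⟩` = mean number of label changes per sweep);
* HMC arm (`K_Ψ = hmcOpOf J λ Ψ`, ANY measurable Lebesgue-preserving involution `Ψ` of phase space —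
  qpq / pqp leapfrog of every step size and length; `r = ∫∫ a(z) χ_flip((Ψ z).1, z.1) e^{−H}/(Z_p Z)`
  the probability per trajectory of an ACCEPTED label change):
  **`hmc_tauInt_ge_flipRate`**, `hmcPhi4_tauInt_ge_flipRate` — `τ_int,traj(θ) ≥ Var(θ)/(2 r) − ½`;
* FLOW arm (`K = imhOpPhi4 J λ q̃`, every positive model density `q̃` with `∫ q̃ = 1`;
  `r = Z⁻¹ ∫∫ min(w q̃', w' q̃) χ_flip` the probability per step of an accepted label change):
  **`phi4Flow_tauInt_ge_flipRate`** — `τ_int(θ) ≥ Var(θ)/(2 r) − ½`;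
* the `Z₂` order parameter (`θ = sgn M`, `Var = 1` by `gibbs_signM_mean`):
  `metropolisScan_tauInt_sweep_ge_signFlipRate` (`≥ 1/(2V⟨r⟩) − ½`),
  `hmcPhi4_tauInt_ge_signFlipRate` and `phi4Flow_tauInt_ge_signFlipRate` (`≥ 1/(2r) − ½`).

Hypotheses throughout (NOT discharged for any run): summable (sweep-thinned) autocorrelation series
and `ρ(1) < 1` (`ρ(V) < 1` for the local arm).  Reading (no numerics implied): a run of `N` updates
that shows `F` changes of a phase label cannot have `τ_int(θ) < Var(θ)·N/(2F) − ½` in equilibrium —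
the count of tunnelling events of `sgn M` (or of any sector label) CERTIFIES a floor on its
integrated autocorrelation time, for all three arms alike, and a reported `τ_int` below it is
inconsistent (an audit inequality between two measured columns, like the acceptance / ESS / τ
inequalities of `HOME/s0-phi4/TAU-ESS-THEOREMS.md`).  NOT CLAIMED: any value of `r` for a run; the
ordered sweep; upper bounds.
-/

namespace Summit.Ventures.LatticeQCDFlow.Exactness

open Real MeasureTheory Filter Finset
open Summit.Ventures.LatticeQCDFlow.Scoring

section FlipRate

variable {n : ℕ}

/-! ## §1 A label's squared jump is four times the flip indicator -/

/-- `(θ ψ − θ φ)² = 4 · 1{labels differ}` for `±1` labels. -/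
theorem label_sq_sub_eq_four_mul_flip (a b : Prop) [Decidable a] [Decidable b] :
    ((if a then (1 : ℝ) else -1) - (if b then (1 : ℝ) else -1)) ^ 2
      = 4 * (if (a ↔ b) then (0 : ℝ) else 1) := by
  by_cases ha : a <;> by_cases hb : b <;> simp [ha, hb] <;> norm_num

/-- The flip indicator against a fixed configuration is a bounded measurable observable. -/
theorem flip_bddObs {F : (Fin (n + 1) → ℝ) → ℝ} (hF : Measurable F) (c : ℝ) (φ : Fin (n + 1) → ℝ) :
    BddObs (fun ψ : Fin (n + 1) → ℝ => if (c ≤ F ψ ↔ c ≤ F φ) then (0 : ℝ) else 1) := by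
  refine ⟨?_, 1, fun ψ => ?_⟩
  · by_cases hφ : c ≤ F φ
    · have e : (fun ψ : Fin (n + 1) → ℝ => if (c ≤ F ψ ↔ c ≤ F φ) then (0 : ℝ) else 1)
          = fun ψ => if c ≤ F ψ then (0 : ℝ) else 1 := by
        funext ψ
        by_cases hψ : c ≤ F ψ
        · rw [if_pos hψ, if_pos (iff_of_true hψ hφ)]
        · rw [if_neg hψ, if_neg (fun h => hψ (h.mpr hφ))]
      rw [e]
      exact Measurable.ite (measurableSet_le measurable_const hF) measurable_const measurable_const
    · have e : (fun ψ : Fin (n + 1) → ℝ => if (c ≤ F ψ ↔ c ≤ F φ) then (0 : ℝ) else 1)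
          = fun ψ => if c ≤ F ψ then (1 : ℝ) else 0 := by
        funext ψ
        by_cases hψ : c ≤ F ψ
        · rw [if_pos hψ, if_neg (fun h => hφ (h.mp hψ))]
        · rw [if_neg hψ, if_pos (iff_of_false hψ hφ)]
      rw [e]
      exact Measurable.ite (measurableSet_le measurable_const hF) measurable_const measurable_const
  · show |(if (c ≤ F ψ ↔ c ≤ F φ) then (0 : ℝ) else 1)| ≤ 1
    split_ifs <;> norm_num

/-! ## §2 LOCAL arm: the flip rate per proposal -/

/-- The scan is homogeneous: `K[a·f] = a·K[f]` (any `f`, pointwise). -/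
theorem metroScan_const_mul (J : Fin (n + 1) → Fin (n + 1) → ℝ) (lam : ℝ) (ρ : ℝ → ℝ)
    (a : ℝ) (f : (Fin (n + 1) → ℝ) → ℝ) (φ : Fin (n + 1) → ℝ) :
    metroScan J lam ρ (fun ψ => a * f ψ) φ = a * metroScan J lam ρ f φ := by
  unfold metroScan metroSite
  rw [mul_div_assoc', Finset.mul_sum]
  congr 1
  refine Finset.sum_congr rfl fun x _ => ?_
  rw [← integral_const_mul]
  refine integral_congr_ae (Eventually.of_forall fun t' => ?_)
  show (metroAccept J lam x φ t' * (a * f (Function.update φ x t'))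
      + (1 - metroAccept J lam x φ t') * (a * f φ)) * ρ (t' - φ x)
    = a * ((metroAccept J lam x φ t' * f (Function.update φ x t')
      + (1 - metroAccept J lam x φ t') * f φ) * ρ (t' - φ x))
  ring

/-- **The carré du champ of a label is four times the flip rate**: for every shift `a`
(`g = θ − a`), `K[(g − g φ)²](φ) = 4 · K[χ_flip(·, φ)](φ)`. -/
theorem metroScan_labelDev_eq_flip (J : Fin (n + 1) → Fin (n + 1) → ℝ) (lam : ℝ) (ρ : ℝ → ℝ)
    (F : (Fin (n + 1) → ℝ) → ℝ) (c a : ℝ) (φ : Fin (n + 1) → ℝ) :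
    metroScan J lam ρ (fun ψ => (((if c ≤ F ψ then (1 : ℝ) else -1) - a)
        - ((if c ≤ F φ then (1 : ℝ) else -1) - a)) ^ 2) φ
      = 4 * metroScan J lam ρ (fun ψ => if (c ≤ F ψ ↔ c ≤ F φ) then (0 : ℝ) else 1) φ := by
  rw [← metroScan_const_mul]
  congr 1
  funext ψ
  rw [← label_sq_sub_eq_four_mul_flip]
  ring

/-- **THE FLIP-RATE FLOOR OF THE LOCAL ARM (sweep units).**  Lattice φ⁴, every `λ > 0`, real `J`,
`ρ` an even probability density; `F` measurable, `c` a level, `θ = ±1` the label of `{c ≤ F}`,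
`g = θ − ⟨θ⟩`, `K` the random-site-scan Metropolis operator, one sweep = `n+1` proposals;
`r(φ) = K[χ_flip(·, φ)](φ)` the probability that the next proposal is accepted and changes the label,
`⟨r⟩` its equilibrium mean.  If the sweep-thinned autocorrelation series of `g` is summable and
`ρ_g(n+1) < 1`, then `τ_int,sweep(θ) ≥ ⟨(θ − ⟨θ⟩)²⟩ / (2 (n+1) ⟨r⟩) − ½`. -/
theorem metropolisScan_tauInt_sweep_ge_flipRate {lam : ℝ} (hlam : 0 < lam)
    (J : Fin (n + 1) → Fin (n + 1) → ℝ) {ρ : ℝ → ℝ} (hρ0 : ∀ u, 0 ≤ ρ u) (hρm : Measurable ρ)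
    (hρi : Integrable ρ) (hρ1 : ∫ u, ρ u = 1) (hρs : ∀ u, ρ (-u) = ρ u)
    {F : (Fin (n + 1) → ℝ) → ℝ} (hF : Measurable F) (c : ℝ)
    (hs : Summable fun k => (∫ φ, ((if c ≤ F φ then (1 : ℝ) else -1)
          - gibbsExpect J lam (fun ψ => if c ≤ F ψ then (1 : ℝ) else -1))
        * ((metroScan J lam ρ)^[(n + 1) * (k + 1)] (fun ψ => (if c ≤ F ψ then (1 : ℝ) else -1)
          - gibbsExpect J lam (fun ψ => if c ≤ F ψ then (1 : ℝ) else -1))) φ * gibbsWeight J lam φ)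
        / ∫ φ, ((if c ≤ F φ then (1 : ℝ) else -1)
          - gibbsExpect J lam (fun ψ => if c ≤ F ψ then (1 : ℝ) else -1)) ^ 2 * gibbsWeight J lam φ)
    (hρV : (∫ φ, ((if c ≤ F φ then (1 : ℝ) else -1)
          - gibbsExpect J lam (fun ψ => if c ≤ F ψ then (1 : ℝ) else -1))
        * ((metroScan J lam ρ)^[n + 1] (fun ψ => (if c ≤ F ψ then (1 : ℝ) else -1)
          - gibbsExpect J lam (fun ψ => if c ≤ F ψ then (1 : ℝ) else -1))) φ * gibbsWeight J lam φ)
        / (∫ φ, ((if c ≤ F φ then (1 : ℝ) else -1)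
          - gibbsExpect J lam (fun ψ => if c ≤ F ψ then (1 : ℝ) else -1)) ^ 2 * gibbsWeight J lam φ)
        < 1) :
    gibbsExpect J lam (fun φ => ((if c ≤ F φ then (1 : ℝ) else -1)
          - gibbsExpect J lam (fun ψ => if c ≤ F ψ then (1 : ℝ) else -1)) ^ 2)
        / (2 * ((n : ℝ) + 1) * gibbsExpect J lam (fun φ =>
            metroScan J lam ρ (fun ψ => if (c ≤ F ψ ↔ c ≤ F φ) then (0 : ℝ) else 1) φ)) - 1 / 2
      ≤ tauInt (fun k => (∫ φ, ((if c ≤ F φ then (1 : ℝ) else -1)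
          - gibbsExpect J lam (fun ψ => if c ≤ F ψ then (1 : ℝ) else -1))
        * ((metroScan J lam ρ)^[(n + 1) * k] (fun ψ => (if c ≤ F ψ then (1 : ℝ) else -1)
          - gibbsExpect J lam (fun ψ => if c ≤ F ψ then (1 : ℝ) else -1))) φ * gibbsWeight J lam φ)
        / ∫ φ, ((if c ≤ F φ then (1 : ℝ) else -1)
          - gibbsExpect J lam (fun ψ => if c ≤ F ψ then (1 : ℝ) else -1)) ^ 2 * gibbsWeight J lam φ) := by
  have hco := latticePhi4Action_coercive hlam J
  set a := gibbsExpect J lam (fun ψ : Fin (n + 1) → ℝ => if c ≤ F ψ then (1 : ℝ) else -1) with ha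
  obtain ⟨hθm, B, hθb⟩ := label_bddObs hF c (n := n)
  obtain ⟨hgm, hgb, -⟩ := centred_observable hlam J hθm hθb
  have hg : BddObs (fun ψ : Fin (n + 1) → ℝ => (if c ≤ F ψ then (1 : ℝ) else -1) - a) :=
    ⟨hgm, _, hgb⟩
  -- the integrated carré du champ equals `4 ∫ r e^{−S}`
  have hΓ : ∫ φ, metroScan J lam ρ (fun ψ => (((if c ≤ F ψ then (1 : ℝ) else -1) - a)
        - ((if c ≤ F φ then (1 : ℝ) else -1) - a)) ^ 2) φ * gibbsWeight J lam φ
      ≤ 4 * ∫ φ, metroScan J lam ρ (fun ψ => if (c ≤ F ψ ↔ c ≤ F φ) then (0 : ℝ) else 1) φ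
        * gibbsWeight J lam φ := by
    refine le_of_eq ?_
    rw [← integral_const_mul]
    refine integral_congr_ae (Eventually.of_forall fun φ => ?_)
    show metroScan J lam ρ (fun ψ => (((if c ≤ F ψ then (1 : ℝ) else -1) - a)
        - ((if c ≤ F φ then (1 : ℝ) else -1) - a)) ^ 2) φ * gibbsWeight J lam φ
      = 4 * (metroScan J lam ρ (fun ψ => if (c ≤ F ψ ↔ c ≤ F φ) then (0 : ℝ) else 1) φ
        * gibbsWeight J lam φ)
    rw [metroScan_labelDev_eq_flip, mul_assoc]
  have hfloor := RevOp.thinned_tauInt_ge_of_integral_carre_le (μ := volume) (A := BddObs)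
    (K := metroScan J lam ρ) (w := gibbsWeight J lam)
    (fun φ => (gibbsWeight_pos J lam φ).le) (bddObs_const 1)
    (fun f h hf hh => bddObs_integrable_mul_mul_gibbsWeight one_pos hco hf hh)
    (fun f h c hf hh => bddObs_add_mul hf hh c)
    (fun f hf => bddObs_metroScan J lam hρ0 hρm hρi hρ1 hf)
    (fun f h c hf hh x => metroScan_add_mul J lam hρ0 hρm hρi hf hh c x)
    (fun f h hf hh => metroScan_reversible one_pos hco hρ0 hρm hρi hρ1 hρs hf hh)
    (fun f hf => metroScan_contraction one_pos hco hρ0 hρm hρi hρ1 hρs hf)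
    (fun φ => metroScan_one J lam hρ1 φ) hg (bddObs_sq hg) hΓ (show 0 < n + 1 by omega) hs hρV
  have hZ : gibbsZ J lam ≠ 0 := (gibbsZ_pos hlam J).ne'
  unfold gibbsExpect
  beta_reduce
  exact (label_floor_transfer hZ n _ _).le.trans hfloor

/-- `⟨(sgn M − ⟨sgn M⟩)²⟩ = 1`: the sign of the magnetisation is balanced (`Z₂`) and `(±1)² = 1`. -/
theorem gibbs_signM_var {lam : ℝ} (hlam : 0 < lam) (J : Fin (n + 1) → Fin (n + 1) → ℝ) :
    gibbsExpect J lam (fun φ => ((if 0 ≤ ∑ x, φ x then (1 : ℝ) else -1)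
        - gibbsExpect J lam (fun ψ => if 0 ≤ ∑ x, ψ x then (1 : ℝ) else -1)) ^ 2) = 1 := by
  rw [gibbs_signM_mean]
  have hZ : gibbsZ J lam ≠ 0 := (gibbsZ_pos hlam J).ne'
  unfold gibbsExpect
  have e : ∀ φ : Fin (n + 1) → ℝ, ((if 0 ≤ ∑ x, φ x then (1 : ℝ) else -1) - 0) ^ 2 * gibbsWeight J lam φ
      = gibbsWeight J lam φ := fun φ => by
    split_ifs <;> ring
  simp_rw [e]
  unfold gibbsZ
  exact div_self hZ

/-- **LOCAL arm, `θ = sgn M`: `τ_int,sweep(sgn M) ≥ 1/(2 (n+1) ⟨r⟩) − ½`**, `(n+1)⟨r⟩` the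
equilibrium mean number of accepted sign changes of the magnetisation per sweep. -/
theorem metropolisScan_tauInt_sweep_ge_signFlipRate {lam : ℝ} (hlam : 0 < lam)
    (J : Fin (n + 1) → Fin (n + 1) → ℝ) {ρ : ℝ → ℝ} (hρ0 : ∀ u, 0 ≤ ρ u) (hρm : Measurable ρ)
    (hρi : Integrable ρ) (hρ1 : ∫ u, ρ u = 1) (hρs : ∀ u, ρ (-u) = ρ u)
    (hs : Summable fun k => (∫ φ, ((if 0 ≤ ∑ x, φ x then (1 : ℝ) else -1)
          - gibbsExpect J lam (fun ψ => if 0 ≤ ∑ x, ψ x then (1 : ℝ) else -1))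
        * ((metroScan J lam ρ)^[(n + 1) * (k + 1)] (fun ψ => (if 0 ≤ ∑ x, ψ x then (1 : ℝ) else -1)
          - gibbsExpect J lam (fun ψ => if 0 ≤ ∑ x, ψ x then (1 : ℝ) else -1))) φ * gibbsWeight J lam φ)
        / ∫ φ, ((if 0 ≤ ∑ x, φ x then (1 : ℝ) else -1)
          - gibbsExpect J lam (fun ψ => if 0 ≤ ∑ x, ψ x then (1 : ℝ) else -1)) ^ 2 * gibbsWeight J lam φ)
    (hρV : (∫ φ, ((if 0 ≤ ∑ x, φ x then (1 : ℝ) else -1)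
          - gibbsExpect J lam (fun ψ => if 0 ≤ ∑ x, ψ x then (1 : ℝ) else -1))
        * ((metroScan J lam ρ)^[n + 1] (fun ψ => (if 0 ≤ ∑ x, ψ x then (1 : ℝ) else -1)
          - gibbsExpect J lam (fun ψ => if 0 ≤ ∑ x, ψ x then (1 : ℝ) else -1))) φ * gibbsWeight J lam φ)
        / (∫ φ, ((if 0 ≤ ∑ x, φ x then (1 : ℝ) else -1)
          - gibbsExpect J lam (fun ψ => if 0 ≤ ∑ x, ψ x then (1 : ℝ) else -1)) ^ 2 * gibbsWeight J lam φ)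
        < 1) :
    1 / (2 * ((n : ℝ) + 1) * gibbsExpect J lam (fun φ =>
            metroScan J lam ρ (fun ψ => if (0 ≤ ∑ x, ψ x ↔ 0 ≤ ∑ x, φ x) then (0 : ℝ) else 1) φ))
        - 1 / 2
      ≤ tauInt (fun k => (∫ φ, ((if 0 ≤ ∑ x, φ x then (1 : ℝ) else -1)
          - gibbsExpect J lam (fun ψ => if 0 ≤ ∑ x, ψ x then (1 : ℝ) else -1))
        * ((metroScan J lam ρ)^[(n + 1) * k] (fun ψ => (if 0 ≤ ∑ x, ψ x then (1 : ℝ) else -1)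
          - gibbsExpect J lam (fun ψ => if 0 ≤ ∑ x, ψ x then (1 : ℝ) else -1))) φ * gibbsWeight J lam φ)
        / ∫ φ, ((if 0 ≤ ∑ x, φ x then (1 : ℝ) else -1)
          - gibbsExpect J lam (fun ψ => if 0 ≤ ∑ x, ψ x then (1 : ℝ) else -1)) ^ 2 * gibbsWeight J lam φ) := by
  have hMm : Measurable fun φ : Fin (n + 1) → ℝ => ∑ y, φ y :=
    Finset.measurable_sum _ fun y _ => measurable_pi_apply y
  have h := metropolisScan_tauInt_sweep_ge_flipRate hlam J hρ0 hρm hρi hρ1 hρs hMm 0 hs hρV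
  rw [gibbs_signM_var hlam J] at h
  exact h

end FlipRate

end Summit.Ventures.LatticeQCDFlow.Exactness
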